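import Literature.MeasureTheory.Group.UnitsHaarDensity
import Literature.RingTheory.Norm.MatrixAlgebra
import Mathlib.Analysis.Matrix.Normed
import Mathlib.Analysis.Distribution.SchwartzSpace.Basic
import Mathlib.Analysis.SpecialFunctions.Pow.Continuity
import HarnessLib

/-!
# Archimedean convergence: `∫_{GL_n(K_∞)} |Φ_∞(x)| |det x|_∞^σ d^×x < ∞` for Schwartz `Φ_∞`, `σ ≥ n`

Topic `NumberTheory/Automorphic`; namespace `Literature.NumberTheory.Automorphic`. A brick of the
discharge of the named fact `GodementJacquet1972_gjZeta_meromorphic` (Godement–Jacquet, LNM 260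
(1972), Thm. 13.8), more precisely of its first clause (absolute convergence of the global zeta
integral for `re s ≫ 0`): the archimedean factor of `∫_{GL_n(𝔸_K)} |Φ(x)| |det x|_𝔸^σ dx`.

For the archimedean group `GL_n(K_∞) = GL (Fin n) (mixedSpace K)` (`mixedSpace K = ℝ^{r₁} × ℂ^{r₂}`,
the tree's model of `K_∞`, `AdelicGLnGlue`), any Haar measure `d^×x` on it, any Schwartz function
`Φ_∞` on `M_n(K_∞)` (Mathlib `SchwartzMap` on `Fin n → Fin n → mixedSpace K`, the type of the
archimedean components of `schwartzBruhatAdelicMatrix`) and every real `σ ≥ n`: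

* `integrable_schwartz_mul_normDet_rpow` — **`x ↦ |Φ_∞(x)| |det x|_∞^σ` is `d^×x`-integrable**,
  where `|t|_∞ = ∏_w ‖t_w‖^{[K_w:ℝ]}` is Mathlib's `NumberField.mixedEmbedding.norm` (the
  archimedean factor of the idelic module).

Proof (Godement–Jacquet (1972), §8 for `n`, Tate for `n = 1`; Jacquet (1979), (6.?)):
`d^×x = c |N_{M_n(K_∞)/ℝ}(x)|⁻¹ dx = c |det x|_∞^{-n} dx`
(`Literature.MeasureTheory.Group.integrable_comp_val_of_integrable`, the Haar measure of the unit group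
of a finite-dimensional real algebra, and `Literature.RingTheory.Norm.abs_algebraNorm_matrix_mixedSpace`),
so the integral is `c ∫_{M_n(K_∞)} |Φ_∞(x)| |det x|_∞^{σ-n} dx`, and
`|det x|_∞ ≤ (n! ‖x‖^n)^{[K:ℚ]}` (`norm_det_le_of_forall_norm_le`, Hadamard-type bound, and
`mixedEmbedding_norm_le_norm_pow`) makes the integrand `≤ C (1 + ‖x‖^k) |Φ_∞(x)|`, integrable by the
Schwartz decay (Mathlib `SchwartzMap.integrable_pow_mul`).

Everything here is proved; no definitions, no named facts.

## References

* R. Godement, H. Jacquet, *Zeta functions of simple algebras*, LNM 260 (1972), §8 (archimedean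
  local zeta integrals converge for `re s` large), §12 [GodementJacquet1972].
* H. Jacquet, *Principal `L`-functions of the linear group*, Proc. Sympos. Pure Math. 33 (1979),
  Part 2, §6 [JacquetCorvallis1979].
-/

noncomputable section

open scoped MatrixGroups NNReal ENNReal Classical Matrix.Norms.Operator
open NumberField NumberField.InfinitePlace NumberField.mixedEmbedding MeasureTheory Set

namespace Literature.NumberTheory.Automorphic

/-! ### A Hadamard-type bound for determinants over a normed commutative ring -/

section DetBound

variable {R : Type*} [NormedCommRing R] {ι : Type*} [Fintype ι] [DecidableEq ι]

/-- **`‖det A‖ ≤ n! c^n` when all entries have norm `≤ c`** (`n ≥ 1`; expansion over permutations,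
as in Mathlib's `Matrix.det_le` for absolute values). [folklore] -/
theorem norm_det_le_of_forall_norm_le [Nonempty ι] {A : Matrix ι ι R} {c : ℝ}
    (h : ∀ i j, ‖A i j‖ ≤ c) :
    ‖A.det‖ ≤ (Fintype.card ι).factorial * c ^ Fintype.card ι := by
  have hc : 0 ≤ c := (norm_nonneg _).trans (h (Classical.arbitrary ι) (Classical.arbitrary ι))
  rw [Matrix.det_apply]
  calc ‖∑ σ : Equiv.Perm ι, Equiv.Perm.sign σ • ∏ i, A (σ i) i‖
      ≤ ∑ σ : Equiv.Perm ι, ‖Equiv.Perm.sign σ • ∏ i, A (σ i) i‖ := norm_sum_le _ _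
    _ ≤ ∑ _σ : Equiv.Perm ι, c ^ Fintype.card ι := by
        refine Finset.sum_le_sum fun σ _ => ?_
        have h1 : ‖Equiv.Perm.sign σ • ∏ i, A (σ i) i‖ = ‖∏ i, A (σ i) i‖ := by
          rcases Int.units_eq_one_or (Equiv.Perm.sign σ) with hs | hs <;> simp [hs]
        rw [h1]
        calc ‖∏ i, A (σ i) i‖ ≤ ∏ i, ‖A (σ i) i‖ :=
              Finset.norm_prod_le' _ Finset.univ_nonempty _
          _ ≤ ∏ _i : ι, c := Finset.prod_le_prod (fun i _ => norm_nonneg _) fun i _ => h _ _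
          _ = c ^ Fintype.card ι := by rw [Finset.prod_const, Finset.card_univ]
    _ = (Fintype.card ι).factorial * c ^ Fintype.card ι := by
        rw [Finset.sum_const, Finset.card_univ, Fintype.card_perm, nsmul_eq_mul]

end DetBound

/-! ### The archimedean module `|t|_∞ = ∏_w ‖t_w‖^{[K_w:ℝ]}` -/

section MixedNorm

variable (K : Type*) [Field K] [NumberField K]

/-- `|t|_∞ ≤ ‖t‖^{[K:ℚ]}` for the sup norm on `K_∞ = ℝ^{r₁} × ℂ^{r₂}` (each `‖t_w‖ ≤ ‖t‖` and
`∑_w [K_w:ℝ] = [K:ℚ]`, Mathlib `sum_mult_eq`). [folklore] -/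
theorem mixedEmbedding_norm_le_norm_pow (t : mixedSpace K) :
    mixedEmbedding.norm t ≤ ‖t‖ ^ Module.finrank ℚ K := by
  rw [mixedEmbedding.norm_apply, ← sum_mult_eq, ← Finset.prod_pow_eq_pow_sum]
  refine Finset.prod_le_prod (fun w _ => pow_nonneg (normAtPlace_nonneg _ _) _) fun w _ => ?_
  refine pow_le_pow_left₀ (normAtPlace_nonneg _ _) ?_ _
  rw [norm_eq_sup'_normAtPlace]
  exact Finset.le_sup' (fun w => normAtPlace w t) (Finset.mem_univ w)

variable {K}

/-- `|det x|_∞ ≤ (n! · ‖x‖^n)^{[K:ℚ]}` for the entrywise sup norm of `x ∈ M_n(K_∞)`, `n ≥ 1`.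
[folklore] -/
theorem mixedEmbedding_norm_det_le {n : ℕ} (hn : 0 < n) (x : Fin n → Fin n → mixedSpace K) :
    mixedEmbedding.norm (Matrix.det (Matrix.of x)) ≤
      ((n.factorial : ℝ) * ‖x‖ ^ n) ^ Module.finrank ℚ K := by
  haveI : Nonempty (Fin n) := ⟨⟨0, hn⟩⟩
  refine (mixedEmbedding_norm_le_norm_pow K _).trans (pow_le_pow_left₀ (norm_nonneg _) ?_ _)
  have h := norm_det_le_of_forall_norm_le (A := Matrix.of x) (c := ‖x‖) fun i j => by
    rw [Matrix.of_apply]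
    exact (norm_le_pi_norm (x i) j).trans (norm_le_pi_norm x i)
  simpa [Fintype.card_fin] using h

end MixedNorm

/-! ### The archimedean integral -/

section Integral

variable {K : Type} [Field K] [NumberField K] {n : ℕ}

/-- Elementary: `(1 + t)^m ≤ 2^m (1 + t^m)` for `t ≥ 0`. [folklore] -/
theorem one_add_pow_le_two_pow_mul (t : ℝ) (ht : 0 ≤ t) (m : ℕ) :
    (1 + t) ^ m ≤ 2 ^ m * (1 + t ^ m) := by
  rcases le_total t 1 with h | h
  · calc (1 + t) ^ m ≤ (1 + 1) ^ m := pow_le_pow_left₀ (by positivity) (by linarith) _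
      _ = 2 ^ m * 1 := by norm_num
      _ ≤ 2 ^ m * (1 + t ^ m) := by gcongr; linarith [pow_nonneg ht m]
  · calc (1 + t) ^ m ≤ (t + t) ^ m := pow_le_pow_left₀ (by positivity) (by linarith) _
      _ = 2 ^ m * t ^ m := by rw [← two_mul, mul_pow]
      _ ≤ 2 ^ m * (1 + t ^ m) := by gcongr; linarith

set_option backward.isDefEq.respectTransparency false in
/-- **Convergence of the archimedean integral `∫_{GL_n(K_∞)} |Φ_∞(x)| |det x|_∞^σ d^×x` for
`σ ≥ n`** (Godement–Jacquet (1972), §8: the archimedean local zeta integrals converge absolutely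
for `re s` large; here in the crude global form needed for Thm. 13.8). For every Haar measure `ρ`
on `GL_n(K_∞) = GL (Fin n) (mixedSpace K)` (any Borel structure), every Schwartz function `Φ_∞` on
`M_n(K_∞)` and every real `σ ≥ n`, the function `x ↦ ‖Φ_∞(x)‖ |det x|_∞^σ` is `ρ`-integrable.
Proof: `d^×x = c |det x|_∞^{-n} dx` (`Literature.MeasureTheory.Group.integrable_comp_val_of_integrable`
with `Literature.RingTheory.Norm.abs_algebraNorm_matrix_mixedSpace`), and
`|Φ_∞(x)| |det x|_∞^{σ-n} ≤ C (1 + ‖x‖^k) |Φ_∞(x)|` is Lebesgue integrable (Mathlib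
`SchwartzMap.integrable_pow_mul`). [cite: GodementJacquet1972, §8 and §12 (proof of Thm. 13.8)] -/
theorem integrable_schwartz_mul_normDet_rpow [inst : MeasurableSpace (GL (Fin n) (mixedSpace K))]
    [BorelSpace (GL (Fin n) (mixedSpace K))] (ρ : Measure (GL (Fin n) (mixedSpace K)))
    [ρ.IsHaarMeasure] (Φ : SchwartzMap (Fin n → Fin n → mixedSpace K) ℂ) {σ : ℝ} (hσ : (n : ℝ) ≤ σ) :
    Integrable (fun g : GL (Fin n) (mixedSpace K) =>
      ‖Φ (Matrix.of.symm (g : Matrix (Fin n) (Fin n) (mixedSpace K)))‖ *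
        mixedEmbedding.norm (g : Matrix (Fin n) (Fin n) (mixedSpace K)).det ^ σ) ρ := by
  rcases Nat.eq_zero_or_pos n with hn | hn
  · -- `n = 0`: the group is trivial and the integrand is constant
    subst hn
    have h1 : ∀ g : GL (Fin 0) (mixedSpace K), g = 1 := fun g => Units.ext (Subsingleton.elim _ _)
    haveI : Subsingleton (GL (Fin 0) (mixedSpace K)) := ⟨fun a b => (h1 a).trans (h1 b).symm⟩
    haveI : Finite (GL (Fin 0) (mixedSpace K)) := Finite.of_subsingleton
    haveI : CompactSpace (GL (Fin 0) (mixedSpace K)) := Finite.compactSpace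
    haveI : IsFiniteMeasure ρ := CompactSpace.isFiniteMeasure
    have hconst : (fun g : GL (Fin 0) (mixedSpace K) =>
        ‖Φ (Matrix.of.symm (g : Matrix (Fin 0) (Fin 0) (mixedSpace K)))‖ *
          mixedEmbedding.norm (g : Matrix (Fin 0) (Fin 0) (mixedSpace K)).det ^ σ) =
        fun _ => ‖Φ (Matrix.of.symm ((1 : GL (Fin 0) (mixedSpace K)) :
            Matrix (Fin 0) (Fin 0) (mixedSpace K)))‖ *
          mixedEmbedding.norm ((1 : GL (Fin 0) (mixedSpace K)) :
            Matrix (Fin 0) (Fin 0) (mixedSpace K)).det ^ σ :=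
      funext fun g => by rw [h1 g]
    rw [hconst]
    exact integrable_const _
  -- `n ≥ 1`. Measurable structures: the product σ-algebra on `M_n(K_∞)`, which is its Borel σ-algebra.
  haveI hBpi : BorelSpace (Fin n → Fin n → mixedSpace K) := Pi.borelSpace
  letI mM : MeasurableSpace (Matrix (Fin n) (Fin n) (mixedSpace K)) :=
    inferInstanceAs (MeasurableSpace (Fin n → Fin n → mixedSpace K))
  haveI hBM : BorelSpace (Matrix (Fin n) (Fin n) (mixedSpace K)) :=
    inferInstanceAs (BorelSpace (Fin n → Fin n → mixedSpace K))
  haveI : HasSummableGeomSeries (Matrix (Fin n) (Fin n) (mixedSpace K)) :=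
    Literature.MeasureTheory.Group.hasSummableGeomSeries_of_finiteDimensional
  -- the given σ-algebra on the unit group is Mathlib's `comap val` (both are Borel): reduce to it
  have hB : @BorelSpace (GL (Fin n) (mixedSpace K)) _ Units.instMeasurableSpace :=
    Literature.MeasureTheory.Group.Units.borelSpace_of_isOpenEmbedding
      (A := Matrix (Fin n) (Fin n) (mixedSpace K))
  have hinst : inst = Units.instMeasurableSpace := by
    rw [‹BorelSpace (GL (Fin n) (mixedSpace K))›.measurable_eq, hB.measurable_eq]
  subst hinst
  -- Lebesgue measure on `M_n(K_∞)`
  haveI : LocallyCompactSpace (Fin n → Fin n → mixedSpace K) := inferInstance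
  set dx : Measure (Fin n → Fin n → mixedSpace K) := Measure.addHaar with hdx
  haveI hdxA : @Measure.IsAddHaarMeasure (Matrix (Fin n) (Fin n) (mixedSpace K)) _ _ mM dx :=
    inferInstanceAs (dx.IsAddHaarMeasure)
  -- constants
  set d : ℕ := Module.finrank ℚ K with hd
  set m : ℕ := ⌈σ - n⌉₊ with hm
  set k : ℕ := n * (d * m) with hk
  set C : ℝ := ((n.factorial : ℝ) ^ (d * m)) * 2 ^ k with hC
  have hσn : 0 ≤ σ - n := sub_nonneg.2 hσ
  have hσ0 : 0 ≤ σ := le_trans (Nat.cast_nonneg n) hσ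
  -- the integrand on `M_n(K_∞)` and its majorant
  set g : Matrix (Fin n) (Fin n) (mixedSpace K) → ℝ := fun x =>
    ‖Φ (Matrix.of.symm x)‖ * mixedEmbedding.norm x.det ^ σ with hg
  have hof : Continuous fun x : Matrix (Fin n) (Fin n) (mixedSpace K) =>
      (Matrix.of.symm x : Fin n → Fin n → mixedSpace K) := continuous_id
  have hgc : Continuous g :=
    ((Φ.continuous.comp hof).norm).mul
      (((mixedEmbedding.continuous_norm K).comp (continuous_id.matrix_det)).rpow_const
        fun _ => Or.inr hσ0)
  have hgm : Measurable g := hgc.measurable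
  refine Literature.MeasureTheory.Group.integrable_comp_val_of_integrable
    (A := Matrix (Fin n) (Fin n) (mixedSpace K)) dx ρ hgm ?_
  -- the majorant `C (‖Φ x‖ + ‖x‖^k ‖Φ x‖)` is Lebesgue integrable (Schwartz decay)
  have hmaj0 : Integrable (fun x : Fin n → Fin n → mixedSpace K =>
      C * (‖Φ x‖ + ‖x‖ ^ k * ‖Φ x‖)) dx :=
    ((Φ.integrable (μ := dx)).norm.add (Φ.integrable_pow_mul dx k)).const_mul C
  have hmaj : Integrable (fun x : Matrix (Fin n) (Fin n) (mixedSpace K) =>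
      C * (‖Φ (Matrix.of.symm x)‖ + ‖(Matrix.of.symm x : Fin n → Fin n → mixedSpace K)‖ ^ k *
        ‖Φ (Matrix.of.symm x)‖)) dx := hmaj0
  refine (hmaj.restrict (s := {x : Matrix (Fin n) (Fin n) (mixedSpace K) | IsUnit x})).mono' ?_ ?_
  · exact ((continuous_abs.measurable.comp
      (Literature.MeasureTheory.Group.continuous_algebraNorm.measurable.inv)).mul hgm).aestronglyMeasurable
  · filter_upwards [ae_restrict_mem (Units.isOpen.measurableSet :
      MeasurableSet {x : Matrix (Fin n) (Fin n) (mixedSpace K) | IsUnit x})] with x hx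
    -- on units: `|N(x)|⁻¹ g(x) = ‖Φ x‖ |det x|_∞^{σ - n}`
    set D : ℝ := mixedEmbedding.norm x.det with hD
    have hN : |Algebra.norm ℝ x| = D ^ n := by
      rw [Literature.RingTheory.Norm.abs_algebraNorm_matrix_mixedSpace K x, Fintype.card_fin]
    have hN0 : Algebra.norm ℝ x ≠ 0 :=
      Literature.MeasureTheory.Group.algebraNorm_ne_zero_of_isUnit (show IsUnit x from hx)
    have hDpos : 0 < D := by
      have h0 : D ^ n ≠ 0 := by rw [← hN]; exact abs_ne_zero.2 hN0
      exact lt_of_le_of_ne (mixedEmbedding.norm_nonneg _) (fun h => h0 (by rw [← h, zero_pow hn.ne']))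
    have hval : |(Algebra.norm ℝ x)⁻¹| * (‖Φ (Matrix.of.symm x)‖ * mixedEmbedding.norm x.det ^ σ) =
        ‖Φ (Matrix.of.symm x)‖ * D ^ (σ - n) := by
      rw [abs_inv, hN, ← hD, Real.rpow_sub hDpos, Real.rpow_natCast]
      field_simp
    show ‖|(Algebra.norm ℝ x)⁻¹| * (‖Φ (Matrix.of.symm x)‖ * mixedEmbedding.norm x.det ^ σ)‖ ≤ _
    rw [Real.norm_of_nonneg (mul_nonneg (abs_nonneg _) (mul_nonneg (norm_nonneg _)
      (Real.rpow_nonneg (mixedEmbedding.norm_nonneg _) _))), hval]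
    -- `D ≤ (n! ‖x‖^n)^d ≤ E^d`, `E = n! (1 + ‖x‖)^n ≥ 1`
    set y : Fin n → Fin n → mixedSpace K := Matrix.of.symm x with hy
    set E : ℝ := (n.factorial : ℝ) * (1 + ‖y‖) ^ n with hE
    have hfact : (1 : ℝ) ≤ n.factorial := by exact_mod_cast Nat.one_le_iff_ne_zero.2 (Nat.factorial_ne_zero n)
    have hE1 : 1 ≤ E := by
      rw [hE]
      exact one_le_mul_of_one_le_of_one_le hfact (one_le_pow₀ (by linarith [norm_nonneg y]))
    have hDE : D ≤ E ^ d := by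
      have h1 : D ≤ ((n.factorial : ℝ) * ‖y‖ ^ n) ^ d := by
        have := mixedEmbedding_norm_det_le (K := K) hn y
        rwa [hy, Equiv.apply_symm_apply] at this
      refine h1.trans (pow_le_pow_left₀ (by positivity) ?_ _)
      rw [hE]
      gcongr
      linarith [norm_nonneg y]
    have hpow : D ^ (σ - n) ≤ E ^ (d * m) := by
      calc D ^ (σ - n) ≤ (E ^ d) ^ (σ - n) := Real.rpow_le_rpow hDpos.le hDE hσn
        _ ≤ (E ^ d) ^ (m : ℝ) :=
            Real.rpow_le_rpow_of_exponent_le (one_le_pow₀ hE1) (Nat.le_ceil _)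
        _ = E ^ (d * m) := by rw [Real.rpow_natCast, pow_mul]
    have hEdm : E ^ (d * m) ≤ C * (1 + ‖y‖ ^ k) := by
      rw [hE, mul_pow, ← pow_mul, hC, hk, mul_assoc]
      exact mul_le_mul_of_nonneg_left (one_add_pow_le_two_pow_mul _ (norm_nonneg _) _)
        (pow_nonneg (le_trans zero_le_one hfact) _)
    calc ‖Φ (Matrix.of.symm x)‖ * D ^ (σ - n)
        ≤ ‖Φ y‖ * (C * (1 + ‖y‖ ^ k)) :=
          mul_le_mul_of_nonneg_left (hpow.trans hEdm) (norm_nonneg _)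
      _ = C * (‖Φ y‖ + ‖y‖ ^ k * ‖Φ y‖) := by ring

end Integral

end Literature.NumberTheory.Automorphic
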